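/-
Copyright: statement-level skeleton of a published paper (lit-balaban cell, Phase-2 proof seat p25, gen 19). No proof
claims beyond what the kernel checks below.
-/
import Literature.MathematicalPhysics.QuantumFieldTheory.BalabanImbrieJaffe1984to88.BIJ88WalkRemainderActivity312
import Literature.MathematicalPhysics.QuantumFieldTheory.BalabanImbrieJaffe1984to88.BIJ88Sect5StatementsPart4

/-!
# `BalabanImbrieJaffe1984to88.BIJ88WalkIneq312Remainder` — T. Bałaban, J. Imbrie, A. Jaffe, *Effective action and
cluster properties of the abelian Higgs model*, Commun. Math. Phys. **114** (1988) 257–315 [BalabanImbrieJaffe1988],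
§5.14 p. 312 [PDF 56], verbatim: *"Summing all terms in X_r gives an observable F_{k,rem}(X_r)."*, *"Having extracted the
desired perturbative terms F^L_{k+1,loc}(X_c), we need to finish the calculation of the remainders by giving a cluster
expansion for ⟨Π_r F_{k,rem}(X_r)⟩_1, with appropriate bounds."*, *"The X_{r′} are disjoint, and each one covers at least
one X_{σ_1}, the support of one of the observables F^{m̄}_{k,loc}."*, *"These considerations lead to the following estimate:
|G_k(X)| ≤ c(F(X))(e^β(L^kε/ε₀)^{1/4−α})^{β′|X∖∪X_c|} Π [c(L^kε)^{−m(c)}e^{−m′(c)}]"* — **THE TYPED LEAF `Ineq312`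
INHABITED BY THE LOCATED REMAINDER FAMILIES OF THE COVARIANCE-SPLIT EXPANSION ON THE §5.13 LAW** (p25 gen 19; v1.2 docfix:
the theorem's tag names the unnumbered estimate preceding (5.14.5), ref-5 g68 xref note; declarations untouched): for the
polymer system of located remainder families `(O, {(obs of X_r, cubes of X_r)}_r)` (the observables `O` that end in
remainder components and the located family of those components), with `Gk = remAt(O,𝒳)/Z` (the normalized remainder
part of the expansion localized at the family, `BIJ88WalkRemainderActivity312.remAt`), r16's leaf
`Ineq312 Q Gk cF obsProd nfree θ β′` holds with `cF (O,𝒳) = K_χ·Λ_O·W_O^{Φ₀(O)}·s^{#𝒳}` (`c(F)`: cutoff derivatives,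
moments, the volume-uniform term count — AND the extra small factor `s = max(η_χ, θ_v^M, θ_w)` of each remainder
component), `obsProd (O,𝒳) = Π_{j∈O} B_ℓ^{|obs j|}` (the large constant per observable), `nfree (O,𝒳) = Σ_r #(X_r ∖ obs cubes)`
(*"|X∖∪X_c|"*), `β′ = 1` (`ineq312_remainder`).

statement-level skeleton of published theorems with citation tags; proofs where landed; nothing here is a claim
about the Yang–Mills mass gap

PDF held: `paper:balaban1988-cmp114-bij-abelian-higgs-effective-action` (journal page = PDF page + 256); p. 312 =
PDF 56 (`p0056.txt` L5, L10–12, L18–19, L27–29 re-read this session, 2026-08-23).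

CITATION HEADER (lean-in-tree rule).  lit-balaban cell (HOME `run/shared/lean/pub/lit-balaban/`), Phase 2, seat p25
gen 19; row **C2.Claim@312** of `HOME/lit-balaban-r16/ROWS-C2-part2.md` (owner r16, referee ref-5; head
`BIJ88Sect5StatementsPart4.Ineq312` INHABITED here for the located remainder families of the Walk lane on the §5.13
model — the head's status is the owner's call).  USED BY NAME, nothing restated: `BIJ88Sect5StatementsPart4.Ineq312`,
`BIJ88Sect5StatementsPart2.PolymerSys` (r16), `BIJ88WalkRemainderActivity312.{remAt, nfreeOf, abs_remAt_div_le}`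
(p25 gen 19), `BIJ88WalkExpansion311.expand`, `BIJ88VertexComponents311.maxArity`, the §5.13 model
`BIJ88PolymerRep5134Gauss.{prec, src}`, `BIJ88SlotMomentsGauss308.fieldLaw` (p36, r-seats).

## What is proved (0 `sorry`, standard axioms, no new `Prop` facts; definitions with bodies: `remSys`, `phi0`)

* `remSys` (located remainder families `(O, 𝒳)` as a `PolymerSys`, `|(O,𝒳)| = Σ_r #X_r`), `phi0` (`Φ₀(O)`),
  **`ineq312_remainder`**.
HONEST SCOPE — THE HEAD-QUESTION CLAUSES (owner r16, ROWS-C2-part2 v2.269 (H1)–(H5); quotations from the x2 renders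
`lit-balaban-r16/renders/cmp114/original-p053-x2.png`, `…-p054-x2.png`, `…-p056-x2.png`):
(H1) OBJECT.  `Gk (O,𝒳) = remAt(O,𝒳)/Z` is the activity of a located REMAINDER family AS PRODUCED by the expansion
(`BIJ88WalkExpansion311.expand`, nothing assumed bounded): every member `X_r` is a set-aside component whose records
say `χ′`-contraction ∨ random-walk term ∨ `≥ M` vertices (`BIJ88WalkRemainderRecords312.expand_groups_isRem_init`) and
carries its observables `lab X_r` with their cubes (print: *"each one covers at least one X_{σ_1}"*).
(H2) SMALL FACTORS.  Both printed kinds are in the conclusion: `θ^{nfree}` (one per cube of the `X_r` not covered by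
their observables — print's `(e^β(L^kε/ε₀)^{1/4−α})^{β′|X∖∪_cX_c|}`) and, inside `cF`, `s^{#𝒳}` — one
`s = max(η_χ, θ_v^M, θ_w)` per remainder component (`BIJ88WalkRemainderSmall312`).  Every abstract input is a NAMED
CLAUSE matched to a printed input and NONE is discharged on the model of record here: `B_ℓ` (brackets of the local
piece; `obsProd`) ↔ *"we only have bounds |F_{k,loc}(X_{σ_1})| ≤ c(L^kε)^{−m(c)}e^{−m′(c)}, coming from our estimates on
perturbation expansions of observables"* (p. 312); `θ_w`, `θ^{#reg p}` (`hwalk`) ↔ *"We give random walk expansions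
for the propagators … The others, localized in region X, have a factor of e^{−cr(e_k)|X|}."* (p. 310) and *"give a
random walk expansion for the difference"* (p. 311); `θ_v`, `cV` (`hvert`) ↔ *"Each factor V^{(k)}(Y) in
Π_{j∈H_β}(d/dt)_{γ_j} produces a factor e^β(L^kε/ε₀)^{1/4−α} in the final estimate. This is obtained in the Gaussian
integration estimate, using the fact that V^{(k)}(Y) is a small polynomial in A^{(k)}, φ^{(k)}."* (p. 309); `η_χ`,
`K_χ`, `Λ_O` (`hE`: the cutoff's derivatives and the moments on the law) ↔ *"Each t-derivative of a χ-factor in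
χ_{Λ₁₂^{(k)},t} gives at least a factor e^β(L^kε/ε₀)^{1/4−α}."* (p. 309); `ρ₀`, `N₀` (locality of the pieces and of the
vertex legs) ↔ *"we define C^{(k)}_{Λ,loc} by cutting off the kernel when the arguments are separated by O(r(e_k))"*
(p. 310) and the localized `V^{(k)}(Y)` (p. 309); `W_O^{Φ₀(O)}` ↔ `c(F(X))` (*"Here m(c), m′(c) depend on the terms in F
in X_{σ_1} or X_c."*, p. 312).
(H3) DECLARED WEAKENING.  Print charges the large constant only for the observables NEAR THE BOUNDARY —
*"× Π_{X_{σ_1} ⊂ X : dist(X_{σ_1}, Λ₁₂^{(k)c}) < r(e_k)} [c(L^kε)^{−m(c)}e^{−m′(c)}]"* — having stated *"By performing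
sufficiently many integrations by parts, we have arranged for enough small factors to beat these large factors in the
remainder terms (at least if X_{r′} is not at the boundary of Λ₁₂^{(k)})."*; our `obsProd (O,𝒳) = Π_{j∈O} B_ℓ^{|obs j|}`
charges EVERY observable of `O`, and the beat of `B_ℓ^{|obs j|}` by `s` is NOT performed: WEAKER THAN PRINT in the
interior.
(H4) BOUNDARY.  *"Near the boundary we have potentially large covariances C^{(k)}_{Λ₁₂^{(k)},loc} − C^{(k)}_{loc} or
C^{(k)}_{Λ₁₂^{(k)},loc}(u_{k+1}) − C^{(k)}_{loc}(u_{k+1}), so we make use of the proximity to Λ₁₂^{(k)c} to provide the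
necessary convergence."* — a clause: the pieces `Cov p` are abstract, no boundary is modelled.
(H5) PRE-CLUSTER-EXPANSION.  Print's `G_k(X_{r′})` additionally absorbs *"We use essentially the same expansion as
before, Mayer-expanding V^{(k)}(Y)'s and interpolating the Gaussian measure. Finally the polymer expansion u = 1 + a
permits us to factor out the normalization."* (p. 312 L12–14); `remAt(O,𝒳)/Z` is the located remainder activity
BEFORE that expansion (the `⟨Π_r F_{k,rem}(X_r)⟩_1` side of the first display, normalized by the free partition
function `Z`); the disjoint unions `X_{r′} ⊇ X_r` are not formed.
Further: contraction-graph components (gen 18); the leaf constrains only the SHAPE `|Gk| ≤ cF·θ^{β′·nfree}·obsProd`.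
NOT summit progress; NOT continuum; NOT Clay.  Imports `BIJ88WalkRemainderActivity312`,
`BIJ88Sect5StatementsPart4`; modifies nothing.
-/

noncomputable section

namespace Literature.MathematicalPhysics.QuantumFieldTheory.BalabanImbrieJaffe1984to88.BIJ88WalkIneq312Remainder

open Classical MeasureTheory Matrix Finset
open scoped BigOperators
open Literature.MathematicalPhysics.QuantumFieldTheory.Balaban1983to89
open B2Eq228Conditioning (weight source)
open BIJ88PolymerRep5134 (corner)
open BIJ88PolymerRep5134Gauss (prec src)
open BIJ88SlotMomentsGauss308 (fieldLaw)
open BIJ88VertexIbp311 (vexp)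
open BIJ88WickDerivatives305 (dlist)
open BIJ88VertexComponents311 (maxArity)
open BIJ88WalkRun311 BIJ88WalkExpansion311 BIJ88WalkRemainderActivity312

variable {ι : Type} [Fintype ι] {κ : Type} [LinearOrder κ] {P : Type} [Fintype P] {β : Type} [DecidableEq β]

/-- **Located remainder families as a polymer system**: the observables `O` ending in remainder components together
with the located family `𝒳 = {(observables of X_r, cubes of X_r)}_r`; size = total number of cubes.
[cite: BalabanImbrieJaffe1988, §5.14 p.312] -/
def remSys (κ β : Type) : BIJ88Sect5StatementsPart2.PolymerSys :=
  ⟨Finset κ × Multiset (Finset κ × Finset β), fun OX => (OX.2.map fun LX => LX.2.card).sum⟩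

/-- The leg potential of the observables `O`, `Φ₀(O) = Σ_{j∈O} (|obs j| + 1 + M·maxArity)` (the exponent of the
volume-uniform term count). [cite: BalabanImbrieJaffe1988, §5.14 p.312] -/
def phi0 {S : Type} (legs : ι → List (S → ℝ)) (obs : κ → List (S → ℝ)) (M : ℕ) (O : Finset κ) : ℕ :=
  ∑ j ∈ O, ((obs j).length + 1 + M * maxArity legs)

variable {α I : Type} [Fintype α] [DecidableEq α] [Fintype I] [DecidableEq I]
  {blk : α → I} {Δ : Matrix α α ℝ} {ℱ : α → ℝ} {W : Finset I}

/-- **THE TYPED LEAF `Ineq312` FOR THE LOCATED REMAINDER FAMILIES ON THE §5.13 LAW**: on the model of record with the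
covariance split `Σ_p Cov p = (prec)⁻¹`, under the bracket/coupling/locality hypotheses of
`BIJ88WalkRemainderActivity312.abs_remAt_div_le` (source `src`; `B′ ≤ B_ℓ` on local pieces, `B′ ≤ θ_w·θ^{#reg}` on
walk pieces, `cV·B_ℓ^{|legs|} ≤ θ_v·θ^{#vc}`, `0 < θ ≤ 1`, `θ_v, θ_w ∈ (0,1]`, `η_χ ∈ [0,1]`, `Σ_{p : C_p u ≠ 0} ρ p ≤ ρ₀`,
`≤ N₀` coupled vertex legs) and, for every `O`, the expectation bound
`|𝔼_W[Π_{legs}Φ·(Π_{dirs t}∂)χ·e^{−V}]| ≤ K_χ·Π_{z∈dirs t}(η_χ‖z‖)·Λ_O` for the remainder terms of `expand 0 O`: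
`Ineq312 remSys (remAt(O,𝒳)/Z) (K_χ·Λ_O·W_O^{Φ₀(O)}·s^{#𝒳}) (Π_{j∈O} B_ℓ^{|obs j|}) (Σ_r #(X_r ∖ obs cubes)) θ 1`,
`W_O = max(1, ρ₀·(Φ₀(O)+N₀))`, `s = max(η_χ, θ_v^M, θ_w)`.
[cite: BalabanImbrieJaffe1988, §5.14 p.312 (estimate preceding (5.14.5))] -/
theorem ineq312_remainder (hPD : (prec blk Δ W (corner ℝ W)).PosDef)
    {Cov : P → Matrix {x : α // blk x ∈ W} {x : α // blk x ∈ W} ℝ} {trig : P → Bool} {c : ι → ℝ}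
    {legs : ι → List ({x : α // blk x ∈ W} → ℝ)} {obs : κ → List ({x : α // blk x ∈ W} → ℝ)} {M : ℕ}
    {χ : ({x : α // blk x ∈ W} → ℝ) → ℝ} {oc : κ → Finset β} {vc : ι → Finset β} {reg : P → Finset β}
    {Dir : Set ({x : α // blk x ∈ W} → ℝ)} {B' ρ : P → ℝ} {cV : ι → ℝ} {Bl θ θv θw ηχ ρ₀ Kχ : ℝ} {Λ : Finset κ → ℝ}
    {N₀ : ℕ}
    (hθ0 : 0 < θ) (hθ1 : θ ≤ 1) (hBl : 1 ≤ Bl) (hB0 : ∀ p, 0 ≤ B' p) (hρ : ∀ p, 0 ≤ ρ p) (hcV0 : ∀ m, 0 ≤ cV m)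
    (hη0 : 0 ≤ ηχ) (hη1 : ηχ ≤ 1) (hθv : 0 < θv) (hθv1 : θv ≤ 1) (hθw : 0 < θw) (hθw1 : θw ≤ 1)
    (hB : ∀ p, ∀ u ∈ Dir, ∀ w ∈ Dir, |(Cov p *ᵥ u) ⬝ᵥ w| ≤ B' p * ρ p)
    (hBf : ∀ p, ∀ u ∈ Dir, |(Cov p *ᵥ u) ⬝ᵥ src blk ℱ W| ≤ B' p * ρ p)
    (hBz : ∀ p, ∀ u ∈ Dir, ‖Cov p *ᵥ u‖ ≤ B' p * ρ p)
    (hcV : ∀ m, |c m| ≤ cV m) (hobs : ∀ j, ∀ w ∈ obs j, w ∈ Dir) (hlegs : ∀ m, ∀ w ∈ legs m, w ∈ Dir)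
    (hloc : ∀ p, trig p = false → B' p ≤ Bl ∧ reg p = ∅) (hwalk : ∀ p, trig p = true → B' p ≤ θw * θ ^ (reg p).card)
    (hvert : ∀ m, cV m * Bl ^ (legs m).length ≤ θv * θ ^ (vc m).card) (hρ₀0 : 0 ≤ ρ₀)
    (hρ₀ : ∀ u ∈ Dir, (∑ p ∈ univ.filter (fun p => Cov p *ᵥ u ≠ 0), ρ p) ≤ ρ₀)
    (hN : ∀ p, ∀ u ∈ Dir,
      (∑ m, ((range (legs m).length).filter fun j => (Cov p *ᵥ u) ⬝ᵥ (legs m).getD j 0 ≠ 0).card) ≤ N₀)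
    (hKχ : 0 ≤ Kχ) (hΛ : ∀ O, 0 ≤ Λ O)
    (hE : ∀ O : Finset κ, ∀ t ∈ expand Cov trig (src blk ℱ W) c legs obs M 0 O, t.consts = 0 →
      |∫ φ, ((t.groups.map fun h => (h.pend : Multiset _)).sum.map fun w => φ ⬝ᵥ w).prod
          * (dlist t.dirs χ φ * vexp c legs φ) ∂(fieldLaw blk Δ ℱ W)|
        ≤ Kχ * (t.dirs.map fun z => ηχ * ‖z‖).prod * Λ O) :
    BIJ88Sect5StatementsPart4.Ineq312 (remSys κ β)
      (fun OX => remAt (prec blk Δ W (corner ℝ W)) Cov trig (src blk ℱ W) c legs obs M χ oc vc reg [] 0 OX.1 OX.2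
        / ∫ φ, weight (prec blk Δ W (corner ℝ W)) φ * source (src blk ℱ W) φ)
      (fun OX => Kχ * Λ OX.1 * (max 1 (ρ₀ * ((phi0 legs obs M OX.1 + N₀ : ℕ) : ℝ))) ^ phi0 legs obs M OX.1
        * (max ηχ (max (θv ^ M) θw)) ^ Multiset.card OX.2)
      (fun OX => ∏ j ∈ OX.1, Bl ^ (obs j).length)
      (fun OX => nfreeOf oc OX.2) θ 1 := by
  intro OX
  obtain ⟨O, 𝒳⟩ := OX
  have hnf : θ ^ ((1 : ℝ) * (nfreeOf oc 𝒳 : ℕ)) = θ ^ nfreeOf oc 𝒳 := by rw [one_mul, Real.rpow_natCast]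
  simp only []
  rw [hnf]
  set Wc := max 1 (ρ₀ * ((phi0 legs obs M O + N₀ : ℕ) : ℝ)) with hWc
  have hW1 : 1 ≤ Wc := le_max_left _ _
  have hW : ρ₀ * ((∑ j ∈ O, ((obs j).length + 1 + M * maxArity legs) + N₀ : ℕ) : ℝ) ≤ Wc := le_max_right _ _
  have h := abs_remAt_div_le (oc := oc) (vc := vc) (reg := reg) (χ := χ) hPD hθ0 hθ1 hBl hB0 hρ hcV0 hη0 hη1 hθv hθv1
    hθw hθw1 hB hBf hBz hcV hobs hlegs hloc hwalk hvert hρ₀0 hρ₀ hN O hW1 hW hKχ (hΛ O) (hE O) 𝒳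
  calc _ ≤ Kχ * Λ O * (Wc ^ (∑ j ∈ O, ((obs j).length + 1 + M * maxArity legs)) * ∏ j ∈ O, Bl ^ (obs j).length)
        * (θ ^ nfreeOf oc 𝒳 * (max ηχ (max (θv ^ M) θw)) ^ Multiset.card 𝒳) := h
    _ = _ := by rw [phi0]; ring

end Literature.MathematicalPhysics.QuantumFieldTheory.BalabanImbrieJaffe1984to88.BIJ88WalkIneq312Remainder

end
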